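import Summits.FinalStateConjecture.FinalStateConjecture.Theses.SuperenergyCensus
import Literature.Geometry.Lorentzian.TameGenericityDiagonal

/-!
# Crux `GenericCountableKerrSettling` (stmt-FinalStateConjecture-17465) — COSTUME THEOREM

Redirect strategist r1 (`planner-cstrat-stmt-FinalStateConjecture-17465-r1-0`, 2026-08-17), route
`route-FinalStateConjecture-SuperenergyCensus` (judge flags: smuggling; attack = 1).

The deciding crux `G = GenericCountableKerrSettling` of the route is, verbatim, the summit's
tame-generic property with the finite index `Fin N` of the final-state decomposition replaced by an
ARBITRARY index type `ι` ("finiteness deliberately absent"), conjoined with MGHD existence, a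
Dafermos–Rodnianski end `(e, M)` of the datum, the remnant-mass bound `Mᵢ ≤ M` and the late
collar-superenergy budget. This file proves, sorry-free:

* `countableFinalState_of_finalStateConjecture` — **the summit implies the analytic core of the
  crux**: `FinalStateConjecture → CountableFinalState`, where `CountableFinalState` is `G` with the
  DR end, the mass bound and the superenergy budget deleted (= the summit with `Fin N ↦ ι`; it still
  contains tame-generic weak cosmic censorship and the settling/exhaustion of the whole domain of
  outer communications to boosted Kerr near zones plus a radiation zone);
* `countableFinalState_of_crux` — `G → CountableFinalState` (the core is a consequence of the crux);
* `costume` — **the summit implies the crux modulo two deterministic FINITE-family ledgers**: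
  `FinalStateConjecture → FinRemnantMassLedger → FinCollarLedger → G`, where the ledgers say that for
  an honestly settled FINITE Kerr family (a `FinalStateDecomposition` with the summit's clauses) in
  an MGHD with complete `𝓘⁺` of an admissible datum, (i) every remnant mass is at most the DR mass
  parameter of the datum's sole end (Bondi bookkeeping) and (ii) the collar superenergies of the
  finitely many holes are frequently-in-`τ` bounded (continuity of the coordinate curvature integral
  under the `C²` convergence the decomposition asserts);
* `crux_iff_summit` — together with the route's certified deciding theorem
  `closes : G → InvertedQuantumCensus → FinalStateConjecture`:
  `InvertedQuantumCensus → FinRemnantMassLedger → FinCollarLedger → (G ↔ FinalStateConjecture)`.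

So MODULO three deterministic statements about settled Kerr configurations — the census (M-sized,
the route's rank-3 item), the finite Bondi mass ledger and the finite collar-continuity ledger, none
of which mentions genericity, censorship or stability — the crux IS the summit: every open piece of
analysis in `G` (tame-generic completeness of `𝓘⁺`; large-data settling of every MGHD to Kerr near
zones exhausting `J⁺(ιX) ∩ I⁻(charts)`) is the corresponding piece of `FinalStateConjecture`, and the
one clause by which `G` is WEAKER than the summit (`ι` arbitrary instead of `Fin N`) is restored by
the census. The BC2/BC7 probes cannot see this (both `G → S` and `S → G` fail mechanically: the
equivalence is modulo the three ledgers), which is why it is recorded here as a theorem.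
-/

set_option linter.dupNamespace false
set_option maxHeartbeats 1600000

namespace Summit.FinalStateConjecture.FinalStateConjecture.Cruxes.GenericCountableKerrSettling.Costume

open scoped BigOperators Topology Manifold Classical MeasureTheory Matrix InnerProductSpace ContDiff
open Filter Set Function TopologicalSpace MeasureTheory
open Literature.Geometry.Lorentzian
open Summit.FinalStateConjecture.FinalStateConjecture.Theses.SuperenergyCensus

/-- **The analytic core of the crux: the summit with `Fin N ↦ ι`.** Verbatim the property of
`GenericCountableKerrSettling` with the DR end `(e, M)`, the remnant-mass bound and the collar
superenergy budget deleted (MGHD existence kept): tame-generically, an MGHD exists and every MGHD has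
complete `𝓘⁺` and an honestly settled `ι`-indexed family of sub-extremal boosted Kerr near zones plus
a flat radiation zone with the summit's separation / covering / `O = exteriorOf` / rays /
honest-radii exhaustion / orientation clauses — `ι` an ARBITRARY type. Equivalent (drop/add the MGHD
conjunct) to the registered stub `stub_countableSettling` of `Lines/birth.lean`.
[cite: DafermosLuk2017, Conjecture 1] [cite: Christodoulou1999, p. A24] -/
def CountableFinalState : Prop :=
  ∀ (X : Type) [TopologicalSpace X] [ChartedSpace Literature.Geometry.Lorentzian.E3 X] [IsManifold (𝓡 3) (⊤ : ℕ∞) X] [T2Space X] [SecondCountableTopology X] [ConnectedSpace X], Literature.Geometry.Lorentzian.InitialDataSet.IsTameChristodoulouGeneric (Literature.Geometry.Lorentzian.admissibleVacuumData X) (fun D ↦ (∃ 𝒟 : Literature.Geometry.Lorentzian.VacuumCauchyDevelopment D, 𝒟.IsMaximal) ∧ ∀ 𝒟 : Literature.Geometry.Lorentzian.VacuumCauchyDevelopment D, 𝒟.IsMaximal → HasCompleteNullInfinity 𝒟.toCauchyDevelopment ∧ ∃ (O : Set 𝒟.carrier) (ι : Type) (mass spin : ι → ℝ) (motion : ι →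 Literature.Geometry.Lorentzian.lorentzGroup × Literature.Geometry.Lorentzian.E4) (τ₀ : ℝ) (Ψ : ∀ i, Literature.Geometry.Lorentzian.boostedKerrExterior (motion i).1 (motion i).2 (mass i) (spin i) → 𝒟.carrier) (ρ : ι → ℝ → ℝ) (U₀ : TopologicalSpace.Opens Literature.Geometry.Lorentzian.E4) (Ψ₀ : U₀ → 𝒟.carrier), let B := fun i ↦ Literature.Geometry.Lorentzian.boostedKerrBackground (motion i).1 (motion i).2 (mass i) (spin i); let M₀ := Literature.Geometry.Lorentzian.Minkowski.backgroundOn U₀; ((∀ i, Literature.Geometry.Lorentzian.Kerr.IsSubextremal (mass i) (spin i)) ∧ (∀ i, 𝒟.IsLateChart (B i) O τ₀ (Ψ i)) ∧ (∀ i R, Tendsto (fun τ ↦ 𝒟.truncDeviationCk (B i) (Ψ i) 2 R τ) atTop (nhds 0))) ∧ ((∀ R, ∃ τ₁, Pairwise (Function.onFun Disjoint fun i ↦ Ψ i '' (B i).truncLateRegion τ₁ R)) ∧ (∀ i, Tendsto (fun t ↦ ρ i t / t) atTop (nhds 0)) ∧ ({x : Literature.Geometry.Lorentzian.E4 | τ₀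 < x 0 ∧ ∀ i, ρ i (x 0) < Literature.Geometry.Lorentzian.Kerr.radius (spin i) (Literature.Geometry.Lorentzian.poincareInv (motion i).1 (motion i).2 x)} ⊆ (U₀ : Set Literature.Geometry.Lorentzian.E4)) ∧ 𝒟.IsLateChart M₀ O τ₀ Ψ₀ ∧ Tendsto (fun τ ↦ 𝒟.deviationCk M₀ Ψ₀ 2 τ) atTop (nhds 0) ∧ (O \ ((⋃ i, Ψ i '' (B i).lateRegion τ₀) ∪ Ψ₀ '' M₀.lateRegion τ₀) ⊆ 𝒟.metric.causalPast 𝒟.timeOrientation ((⋃ i, Ψ i '' (B i).timeSlab τ₀) ∪ Ψ₀ '' M₀.timeSlab τ₀)) ∧ (∃ R : ι → ℝ → ℝ, (∀ i, Tendsto (R i) atTop atTop ∧ ∀ τ, max (Literature.Geometry.Lorentzian.Kerr.rPlus (mass i) (spin i)) 0 + 1 ≤ R i τ) ∧ (∀ i, Tendsto (fun τ ↦ 𝒟.truncDeviationCk (B i) (Ψ i) 2 (R i τ) τ) atTop (nhds 0)) ∧ ∀ τ₁, τ₀ < τ₁ → O \ (Ψ₀ '' M₀.lateRegion τ₁ ∪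 ⋃ i, Ψ i '' {x | τ₁ < (B i).time x.1 ∧ (B i).radius x.1 ≤ R i ((B i).time x.1)}) ⊆ 𝒟.metric.causalPast 𝒟.timeOrientation (Ψ₀ '' M₀.timeSlab τ₁ ∪ ⋃ i, Ψ i '' (B i).truncTimeSlab (R i τ₁) τ₁))) ∧ O = exteriorOf 𝒟.toCauchyDevelopment (Ψ₀ '' M₀.lateRegion τ₀ ∪ ⋃ i, Ψ i '' (B i).lateRegion τ₀) ∧ RaysStayInClosure 𝒟.toCauchyDevelopment O ∧ ((∀ i, IsOrthochronous (motion i).1) ∧ (∀ i r, ∀ᶠ τ in atTop, ∀ x ∈ (B i).truncTimeSlab r τ, 𝒟.timeOrientation.IsFutureDirected (mfderiv 𝓘(ℝ, Literature.Geometry.Lorentzian.E4) (𝓡 4) (Ψ i) x (((motion i).1 : Literature.Geometry.Lorentzian.E4 ≃L[ℝ] Literature.Geometry.Lorentzian.E4) (Literature.Geometry.Lorentzian.Kerr.timeVector (mass i) (spin i) (Literature.Geometry.Lorentzian.poincareInv (motion i).1 (motion i).2 x.1))))) ∧ ∀ᶠ τ in atTop, ∀ x ∈ M₀.timeSlab τ,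 𝒟.timeOrientation.IsFutureDirected (mfderiv 𝓘(ℝ, Literature.Geometry.Lorentzian.E4) (𝓡 4) Ψ₀ x (Literature.Geometry.Lorentzian.E4.basisVector 0)))) 1

/-- **Finite remnant-mass ledger** (deterministic, finite families only): for every admissible datum
with sole DR end `(e, M)`, every MGHD with complete `𝓘⁺`, and every honestly settled FINITE Kerr
family `d` (a `FinalStateDecomposition … O 2` with the summit's clauses: sub-extremal,
`O = exteriorOf … d.charted`, `RaysStayInClosure`, `HasExhaustiveCharts`, `IsFutureOriented`), every
remnant mass satisfies `d.mass i ≤ M`. Bondi bookkeeping `M_ADM ≥ lim M_Bondi ≥ Σ γᵢ Mᵢ ≥ Mᵢ`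
(Bondi–van der Burg–Metzner 1962; positivity of the Bondi mass). The `ι`-indexed strengthening is
`stub_remnantMassBound` of `Lines/birth.lean`. [cite: BondiVanderburgMetzner1962] -/
def FinRemnantMassLedger : Prop :=
  ∀ (X : Type) [TopologicalSpace X] [ChartedSpace Literature.Geometry.Lorentzian.E3 X] [IsManifold (𝓡 3) (⊤ : ℕ∞) X] [T2Space X] [SecondCountableTopology X] [ConnectedSpace X], ∀ D ∈ Literature.Geometry.Lorentzian.admissibleVacuumData X, ∀ (e : Literature.Geometry.Lorentzian.AFEnd X) (M : ℝ), e.IsSoleEnd → e.IsStronglyAsymptoticallyFlatDR D M → ∀ 𝒟 : Literature.Geometry.Lorentzian.VacuumCauchyDevelopment D, 𝒟.IsMaximal → HasCompleteNullInfinity 𝒟.toCauchyDevelopment → ∀ (O : Set 𝒟.carrier) (d : Literature.Geometry.Lorentzian.FinalStateDecomposition 𝒟.toSpacetime O 2), (∀ i, Literature.Geometry.Lorentzian.Kerr.IsSubextremal (d.mass i) (d.spin i)) → O = exteriorOf 𝒟.toCauchyDevelopment d.charted → RaysStayInClosure 𝒟.toCauchyDevelopment O → HasExhaustiveCharts d →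 IsFutureOriented d → ∀ i, d.mass i ≤ M

/-- **Finite collar-superenergy ledger** (deterministic, finite families only): for every admissible
datum, every MGHD with complete `𝓘⁺` and every honestly settled FINITE Kerr family `d` with the
summit's clauses, the coordinate Bel–Robinson collar superenergies
`𝓔ᵢ(τ) = (1/8)∫_{t*ᵢ = τ, r₊ < rᵢ ≤ 4Mᵢ} |Rm_{Ψᵢ*g}|²_ĝ dμ_{H³}` (verbatim the crux's integrand, hole
charts `d.chart i`, backgrounds `boostedKerrBackground (d.motion i) (d.mass i) (d.spin i)`) satisfy
`∃ C < ⊤, ∀ s : Finset (Fin d.N), ∃ᶠ τ, Σ_{i∈s} 𝓔ᵢ(τ) ≤ C`. Expected from the `C²` convergence on the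
collars that `d` itself asserts (`𝓔ᵢ(τ) → J(Λᵢ)·𝓔_Kerr(Mᵢ, aᵢ)`, finitely many `i`); the `ι`-indexed
strengthening is `stub_collarBudget` of `Lines/birth.lean`. [cite: Senovilla2000, §§2–4] -/
def FinCollarLedger : Prop :=
  ∀ (X : Type) [TopologicalSpace X] [ChartedSpace Literature.Geometry.Lorentzian.E3 X] [IsManifold (𝓡 3) (⊤ : ℕ∞) X] [T2Space X] [SecondCountableTopology X] [ConnectedSpace X], ∀ D ∈ Literature.Geometry.Lorentzian.admissibleVacuumData X, ∀ 𝒟 : Literature.Geometry.Lorentzian.VacuumCauchyDevelopment D, 𝒟.IsMaximal → HasCompleteNullInfinity 𝒟.toCauchyDevelopment → ∀ (O : Set 𝒟.carrier) (d : Literature.Geometry.Lorentzian.FinalStateDecomposition 𝒟.toSpacetime O 2), (∀ i, Literature.Geometry.Lorentzian.Kerr.IsSubextremal (d.mass i) (d.spin i)) → O = exteriorOf 𝒟.toCauchyDevelopment d.charted → RaysStayInClosure 𝒟.toCauchyDevelopment O → HasExhaustiveCharts d → IsFutureOriented d → let B := fun i ↦ Literature.Geometry.Lorentzian.boostedKerrBackground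 (d.motion i).1 (d.motion i).2 (d.mass i) (d.spin i); let G := fun i w ↦ 𝒟.deviationExtend (B i) (d.chart i) w + (B i).bilin w; ∃ C < (⊤ : ENNReal), ∀ s : Finset (Fin d.N), ∃ᶠ τ in atTop, (∑ i ∈ s, ∫⁻ y in {y | y ∈ (B i).domain ∧ (B i).time y = τ ∧ (B i).radius y ≤ 4 * d.mass i}, ENNReal.ofReal ((1 / 8 : ℝ) * Literature.Geometry.Lorentzian.MetricCoord.tnormSq (fun z ↦ G i z + (2 * (-((fderiv ℝ (B i).time z) (Literature.Geometry.Lorentzian.MetricCoord.sharpAt (G i) z (fderiv ℝ (B i).time z))))⁻¹) • Literature.Geometry.Lorentzian.E4.tmul (fderiv ℝ (B i).time z) (fderiv ℝ (B i).time z)) (EuclideanSpace.basisFun (Fin 4) ℝ).toBasis (Literature.Geometry.Lorentzian.MetricCoord.rm4 (G i) (EuclideanSpace.basisFun (Fin 4) ℝ).toBasis) y) ∂μH[3]) ≤ C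

/-- **The summit implies the analytic core of the crux** (`Fin N ↦ ι` is a weakening and nothing
else): given the summit's finite decomposition `d` of an MGHD, take `ι := Fin d.N` and the fields of
`d`; every clause of the core is a structure field of `d` or the body of `HasExhaustiveCharts d` /
`IsFutureOriented d` / `d.charted`, definitionally. [folklore] -/
theorem countableFinalState_of_finalStateConjecture (hS : FinalStateConjecture) :
    CountableFinalState := by
  intro X _ _ _ _ _ _
  refine (hS X).mono fun D _hD h ↦ ⟨h.1, fun 𝒟 hmax ↦ ?_⟩
  obtain ⟨hscri, O, d, hsub, hO, hrays, hexh, horient⟩ := h.2 𝒟 hmax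
  exact ⟨hscri, O, Fin d.N, d.mass, d.spin, d.motion, d.τ₀, d.chart, d.excision, d.flatDomain,
    d.flatChart, ⟨hsub, d.isLateChart, d.tendsto_truncDeviationCk⟩,
    ⟨d.exists_pairwise_disjoint, d.tendsto_excision_div, d.setOf_lt_excision_subset_flatDomain,
      d.isLateChart_flat, d.tendsto_deviationCk_flat, d.diff_subset_causalPast, hexh⟩,
    hO, hrays, horient⟩

/-- The crux implies its analytic core (drop the DR end, the mass bound and the budget under
monotonicity of tame genericity). [folklore] -/
theorem countableFinalState_of_crux (h : GenericCountableKerrSettling) : CountableFinalState := by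
  intro X _ _ _ _ _ _
  refine (h X).mono fun D _ hP ↦ ⟨hP.1, fun 𝒟 hmax ↦ ?_⟩
  obtain ⟨hscri, e, M, hAF, O, ι, mass, spin, motion, τ₀, Ψ, ρ, U₀, Ψ₀, hnear, hfar, hO, hrays,
    horient, hmass, hSE⟩ := hP.2 𝒟 hmax
  exact ⟨hscri, O, ι, mass, spin, motion, τ₀, Ψ, ρ, U₀, Ψ₀, hnear, hfar, hO, hrays, horient⟩

/-- **COSTUME THEOREM.** The summit implies the crux modulo the two deterministic finite-family
ledgers: for a tame-generic datum take the summit's MGHD and, for every MGHD, its finite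
decomposition `d`; re-read it as an `ι := Fin d.N`-indexed family (every clause definitionally a
field of `d` or the body of `HasExhaustiveCharts` / `IsFutureOriented` / `charted`), take the DR end
`(e, M)` from admissibility, the mass bound from `FinRemnantMassLedger` and the budget from
`FinCollarLedger`. Tame Christodoulou genericity is monotone in the property
(`IsTameChristodoulouGeneric.mono`). [folklore] -/
theorem costume (hS : FinalStateConjecture) (hM : FinRemnantMassLedger) (hB : FinCollarLedger) :
    GenericCountableKerrSettling := by
  intro X _ _ _ _ _ _
  refine (hS X).mono fun D hD h ↦ ⟨h.1, fun 𝒟 hmax ↦ ?_⟩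
  obtain ⟨hscri, O, d, hsub, hO, hrays, hexh, horient⟩ := h.2 𝒟 hmax
  obtain ⟨e, hsole, M, hAF⟩ := exists_isSoleEnd_of_mem_admissibleVacuumData hD
  have hmass := hM X D hD e M hsole hAF 𝒟 hmax hscri O d hsub hO hrays hexh horient
  have hSE := hB X D hD 𝒟 hmax hscri O d hsub hO hrays hexh horient
  exact ⟨hscri, e, M, hAF, O, Fin d.N, d.mass, d.spin, d.motion, d.τ₀, d.chart, d.excision,
    d.flatDomain, d.flatChart, ⟨hsub, d.isLateChart, d.tendsto_truncDeviationCk⟩,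
    ⟨d.exists_pairwise_disjoint, d.tendsto_excision_div, d.setOf_lt_excision_subset_flatDomain,
      d.isLateChart_flat, d.tendsto_deviationCk_flat, d.diff_subset_causalPast, hexh⟩,
    hO, hrays, horient, hmass, hSE⟩

/-- **The crux is the summit in costume**: modulo the census (the route's rank-3 item, deterministic,
M-sized) and the two finite-family ledgers, `GenericCountableKerrSettling ↔ FinalStateConjecture`
(`→`: the route's certified `closes`; `←`: `costume`). [folklore] -/
theorem crux_iff_summit (hC : InvertedQuantumCensus) (hM : FinRemnantMassLedger)
    (hB : FinCollarLedger) : GenericCountableKerrSettling ↔ FinalStateConjecture :=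
  ⟨fun hG ↦ closes hG hC, fun hS ↦ costume hS hM hB⟩

end Summit.FinalStateConjecture.FinalStateConjecture.Cruxes.GenericCountableKerrSettling.Costume
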